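import Literature.AlgebraicGeometry.Motives.TheoremOfCubeLimit
import Literature.AlgebraicGeometry.Motives.TrivialLocusBaseChange
import Literature.AlgebraicGeometry.Limits.CartierDivisorLinEquiv
import Literature.AlgebraicGeometry.Limits.CartierDivisorDescent
import HarnessLib

/-!
# Noetherian descent of the cube data (proof of `theoremOfCube_noetherianDescent` up to the
# descent of the fibre condition)

`Motives/TheoremOfCubeLimit` reduces the local form of the theorem of the cube over a general
integral base (`theoremOfCube_isTrivialOver_nhds`, Görtz–Wedhorn II, Lemma 24.72) to the locally
noetherian case and to the named fact `theoremOfCube_noetherianDescent`: around a point `t` of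
the trivial locus `Z(D)` the cube data `(D, D|_{{x} × Y × T} ∼ 0, D|_{X × {y} × T} ∼ 0, t ∈ Z(D))`
descend to a base `T₀` of finite type. This file PROVES that fact from the limit formalism of
`Literature/AlgebraicGeometry/Limits` (The Stacks Project, Tag 01YT; Görtz–Wedhorn I, (10.13)),
except for the descent of the fibre condition `t ∈ Z(D)`, which is isolated as the named fact
`trivialLocus_descendsAlongStages` (a second limit argument, over the fibre
`P_{κ(t)} = lim_λ P_{κ(t_λ)}`):

1. localise: `t = j(t')` for an open immersion `j : Spec B → T` of `K`-schemes, `B` a domain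
   (`exists_specOver_hom_apply_eq`); the restriction `D₁ = (P × j)^* D` keeps trivial slices and
   `t' ∈ Z(D₁)` (`Motives/TrivialLocusBaseChange`);
2. `(P ⊗ Spec B).left = lim_t (P ⊗ Spec K[t]).left` over the finitely generated subalgebras
   (`SubalgApprox.isLimitProdCone`, `Limits/SubalgebraDiagram`), and `D₁` is the pullback of a
   divisor `E₀` on a stage `t₀` (`exists_sameDivisor_pullback_π`, `Limits/CartierDivisorDescent`;
   The Stacks Project, Lemma 0B8W (2));
3. the two slices of `E₀`, trivial after pullback to the limit of the `Y`- resp. `X`-system, are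
   trivial on finer stages `t₁`, `t₂` (`exists_linEquiv_zero_pullback_map`,
   `Limits/CartierDivisorLinEquiv`; Lemma 01ZR (2), (3)); the slice of a base change is the base
   change of the slice (Mathlib `whisker_exchange`);
4. the fibre condition descends to a stage `t₃` (`trivialLocus_descendsAlongStages`);
5. on a common refinement `t₄`: `T₀ = Spec K[t₄]` (integral, of finite type, all products integral,
   `Spec B → Spec K[t₄]` dominant — instances of `Limits/SubalgebraDiagram`,
   `Limits/RatFnLimitDescent`), `φ = π_{t₄}`, `D₀ = E₀` pulled back to `t₄`.

Results: `theoremOfCube_noetherianDescent_of_trivialLocus_descends`, and with the bridge of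
`Motives/TheoremOfCubeLimit`,
`theoremOfCube_isTrivialOver_nhds_of_cube_stepI_of_formalFunctions_of_fibre`: the trust base of
`theoremOfCube_isTrivialOver_nhds` becomes Step (I), the theorem on formal functions for `H⁰` of
`𝒪(D)`, and `trivialLocus_descendsAlongStages`.

**Discharge (Part II of this file).** The named fact `trivialLocus_descendsAlongStages` is
PROVED below (`trivialLocus_descendsAlongStages_holds`): the fibre
`P_{κ(t')} = (P ⊗ Spec κ(𝔭)).left` is presented as the limit of the fibres
`P_{κ(t'_t)} = (P ⊗ Spec κ(𝔭 ∩ K[t])).left` of the stages (`ResidueFieldApprox.isLimitFibCone`: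
`κ(𝔭) = Frac(B/𝔭)` is the directed union of the residue fields `κ(𝔭 ∩ K[t])` of the stages at
the images of `t'`, Mathlib `Ideal.ResidueField`, and `(P ⊗ -).left` preserves the limits of
`K`-schemes computed in `Scheme`, `isLimitTensorLeftCone`), a cofiltered limit of integral schemes
with affine surjective transition maps, to which `exists_linEquiv_zero_pullback_map`
(`Limits/CartierDivisorLinEquiv`; The Stacks Project, Lemma 32.10.2 = Tag 01ZR (2), (3)) applies;
the residue fields of the affine schemes `Spec K[t]`, `Spec B` are identified with
`κ(𝔭 ∩ K[t])`, `κ(𝔭)` by Mathlib's `Scheme.Spec.residueFieldIso`. Consequently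
`theoremOfCube_noetherianDescent` holds outright (`theoremOfCube_noetherianDescent_holds`).

## References

* U. Görtz, T. Wedhorn, *Algebraic Geometry II: Cohomology of Schemes*, Springer Spektrum (2023),
  doi:10.1007/978-3-658-43031-3: Lemma 24.72, pp. 548–549; Thm. 23.133, proof, Step (IV), p. 479;
  Thm. 24.66 (1), p. 543. [GortzWedhorn2023]
* U. Görtz, T. Wedhorn, *Algebraic Geometry I: Schemes*, 2nd ed. (2020): (10.13), pp. 321–323;
  Thm. 10.57, Thm. 10.60, Exercises 10.32 (b), 10.33. [GortzWedhorn2020]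
* The Stacks Project, Tag 01YT: Lemmas 0B8W, 01ZR. [StacksProject]
-/

universe u

open CategoryTheory CategoryTheory.Limits AlgebraicGeometry MonoidalCategory
open CartesianMonoidalCategory
open Literature.AlgebraicGeometry.Motives.RatFn
open Literature.AlgebraicGeometry.Limits Literature.AlgebraicGeometry.Limits.SubalgApprox

noncomputable section

namespace Literature.AlgebraicGeometry.Motives

set_option backward.isDefEq.respectTransparency false

variable {K : Type u} [Field K]

/-! ### The fibre condition along the stages (named fact) -/

/-- **The fibre condition `t ∈ Z` descends along `Spec B = lim_t Spec K[t]`**: for `P → Spec K`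
proper and geometrically integral, `B` a `K`-algebra which is a domain, a stage `t₀` of the system
of finitely generated subalgebras `K[t] ⊆ B` (`Limits/SubalgebraDiagram`), a Cartier divisor `E₀`
on `(P ⊗ Spec K[t₀]).left` and a point `t'` of `Spec B` such that the fibre of `π_{t₀}^* E₀` over
`t'` is trivial (`t' ∈ Z(π_{t₀}^* E₀)`, `CartierDivisor.trivialLocus`), there is a finer stage
`f : t₁ → t₀` such that the fibre of `(D f)^* E₀` over the image `t'_{t₁}` of `t'` in `Spec K[t₁]`
is trivial. Printed source: the injectivity half of `Pic(lim S_i) = colim Pic(S_i)` (The Stacks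
Project, Lemma 01ZR (2), (3), cf. Lemma 0B8W; Görtz–Wedhorn I, Exercise 10.32 (b)) applied to the
fibre `P_{κ(t')} = lim_t P_{κ(t'_t)}` — the residue field of the point `t'` of the limit
`Spec B = lim Spec K[t]` being the union of the residue fields of its images (`κ(t') = Frac(B/𝔭)`,
`κ(t'_t) = Frac(K[t]/𝔭 ∩ K[t])`), a limit of integral schemes of finite type over fields with affine
(indeed surjective, flat) transition maps. Elementary; to be proved from
`Limits/CartierDivisorLinEquiv` once the limit presentation of the fibre is in the tree.
[cite: StacksProject, Tag 01ZR (2), (3) and Tag 0B8W; GortzWedhorn2020, Exercise 10.32 (b) (p. 353)] -/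
def trivialLocus_descendsAlongStages : Prop :=
  ∀ (K : Type u) [Field K] (P : SchemeOver K) [IsProper P.hom] [GeometricallyIntegral P.hom]
    (B : Type u) [CommRing B] [Algebra K B] [IsDomain B] (s₁ : Finset B)
    [IsIntegral (P ⊗ specOver K B).left] (t₀ : (Idx B s₁)ᵒᵖ)
    (E₀ : CartierDivisor ((prodDiagram K B s₁ P).obj t₀)) (t' : (specOver K B).left),
    t' ∈ CartierDivisor.trivialLocus P (specOver K B) (E₀.pullback (leg B s₁ P t₀)) →
    ∃ (t₁ : (Idx B s₁)ᵒᵖ) (f : t₁ ⟶ t₀),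
      haveI : IsIntegral (P ⊗ (baseDiagram K B s₁).obj t₁).left :=
        SubalgApprox.isIntegral_prodDiagram_obj B s₁ P t₁
      ((baseCone K B s₁).π.app t₁).left t' ∈
        CartierDivisor.trivialLocus P ((baseDiagram K B s₁).obj t₁)
          (E₀.pullback ((prodDiagram K B s₁ P).map f))

/-! ### Bookkeeping on `P ⊗ -` -/

/-- `(P ⊗ V).left` is integral for an open immersion `j : V → T` with `(P ⊗ T).left` integral and
`V` non-empty (an open subscheme with a point over `v ∈ V`). [folklore] -/
theorem isIntegral_tensorObj_left_of_isOpenImmersion (P : SchemeOver K) {V T : SchemeOver K}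
    (j : V ⟶ T) [IsOpenImmersion j.left] [IsIntegral (P ⊗ T).left] (v : V.left) :
    IsIntegral (P ⊗ V).left := by
  obtain ⟨z⟩ := (inferInstance : Nonempty (P ⊗ T).left)
  obtain ⟨w, -, -⟩ := Scheme.Pullback.exists_preimage_pullback (f := P.hom) (g := V.hom)
    (pullback.fst P.hom T.hom z) v (Subsingleton.elim _ _)
  haveI : Nonempty (P ⊗ V).left := ⟨w⟩
  exact isIntegral_of_isOpenImmersion (P ◁ j).left

variable (P : SchemeOver K) {Y : SchemeOver K} (fY : Y ⟶ P) {T' T : SchemeOver K} (g : T' ⟶ T)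
  [IsIntegral (P ⊗ T).left] [IsIntegral (P ⊗ T').left] [IsIntegral (Y ⊗ T).left]
  [IsIntegral (Y ⊗ T').left]

/-- **The base change of the slice is the slice of the base change** (Mathlib `whisker_exchange`:
`(Y ◁ g) ≫ (f ▷ T) = (f ▷ T') ≫ (P ◁ g)`): if `D' ∼ (P × g)^* E` and the `f`-slice of `D'` is
trivial, then the `f`-slice of `E` becomes trivial after the base change `Y × g`. [folklore] -/
theorem linEquiv_zero_classPullback_slice_whiskerLeft {E : CartierDivisor (P ⊗ T).left}
    {D' : CartierDivisor (P ⊗ T').left} (hrel : D'.LinEquiv (E.classPullback (P ◁ g).left))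
    (h : (D'.classPullback (fY ▷ T').left).LinEquiv 0) :
    ((E.classPullback (fY ▷ T).left).classPullback (Y ◁ g).left).LinEquiv 0 := by
  have e : (Y ◁ g).left ≫ (fY ▷ T).left = (fY ▷ T').left ≫ (P ◁ g).left := by
    rw [← Over.comp_left, ← Over.comp_left, whisker_exchange]
  refine ((CartierDivisor.classPullback_comp_linEquiv _ _ E).symm.trans ?_)
  rw [CartierDivisor.classPullback_congr e]
  exact ((CartierDivisor.classPullback_comp_linEquiv _ _ E).trans
    ((hrel.symm.classPullback _))).trans h

/-- Conversely, **if the base change of the slice of `E` along `Y × g` is trivial, the slice of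
the base change `(P × g)^* E` is trivial**. [folklore] -/
theorem linEquiv_zero_slice_classPullback_whiskerLeft {E : CartierDivisor (P ⊗ T).left}
    (h : ((E.classPullback (fY ▷ T).left).classPullback (Y ◁ g).left).LinEquiv 0) :
    ((E.classPullback (P ◁ g).left).classPullback (fY ▷ T').left).LinEquiv 0 := by
  have e : (fY ▷ T').left ≫ (P ◁ g).left = (Y ◁ g).left ≫ (fY ▷ T).left := by
    rw [← Over.comp_left, ← Over.comp_left, whisker_exchange]
  refine ((CartierDivisor.classPullback_comp_linEquiv _ _ E).symm.trans ?_)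
  rw [CartierDivisor.classPullback_congr e]
  exact (CartierDivisor.classPullback_comp_linEquiv _ _ E).trans h

/-! ### The assembly -/

/-- **Noetherian descent of the cube data, from the descent of the fibre condition**
(`theoremOfCube_noetherianDescent` of `Motives/TheoremOfCubeLimit` — The Stacks Project, Lemmas
0B8W (2), 01ZR (2), (3); Görtz–Wedhorn I, Thm. 10.60, Exercises 10.32 (b), 10.33; used as in
Görtz–Wedhorn II, Thm. 23.133, proof, Step (IV) — proved from the limit formalism of
`Literature/AlgebraicGeometry/Limits`, granted `trivialLocus_descendsAlongStages`). See the module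
docstring for the five steps.
[cite: GortzWedhorn2023, Thm. 23.133, proof, Step (IV) (p. 479), as used for Lemma 24.72 (p. 548)] -/
theorem theoremOfCube_noetherianDescent_of_trivialLocus_descends
    (hfib : trivialLocus_descendsAlongStages.{u}) : theoremOfCube_noetherianDescent.{u} := by
  intro K _ X Y T _ _ _ _ _ _ _ _ x y D hx hy t ht
  classical
  -- Step 1: an affine open neighbourhood `Spec B ∋ t'` of `t = j(t')`
  obtain ⟨B, _, _, _, j, hj, t', ht'⟩ := exists_specOver_hom_apply_eq T t
  haveI := hj
  haveI : IsIntegral ((X ⊗ Y) ⊗ specOver K B).left :=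
    isIntegral_tensorObj_left_of_isOpenImmersion (X ⊗ Y) j t'
  haveI : IsIntegral (Y ⊗ specOver K B).left := isIntegral_tensorObj_left_of_isOpenImmersion Y j t'
  haveI : IsIntegral (X ⊗ specOver K B).left := isIntegral_tensorObj_left_of_isOpenImmersion X j t'
  set fY : Y ⟶ X ⊗ Y := (λ_ Y).inv ≫ x ▷ Y with hfY
  set fX : X ⟶ X ⊗ Y := (ρ_ X).inv ≫ X ◁ y with hfX
  set D₁ := D.classPullback ((X ⊗ Y) ◁ j).left with hD₁
  have hx₁ : (D₁.classPullback (fY ▷ specOver K B).left).LinEquiv 0 :=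
    CartierDivisor.linEquiv_zero_classPullback_whiskerRight_whiskerLeft (X ⊗ Y) j fY hx
  have hy₁ : (D₁.classPullback (fX ▷ specOver K B).left).LinEquiv 0 :=
    CartierDivisor.linEquiv_zero_classPullback_whiskerRight_whiskerLeft (X ⊗ Y) j fX hy
  have ht₁ : t' ∈ CartierDivisor.trivialLocus (X ⊗ Y) (specOver K B) D₁ :=
    CartierDivisor.mem_trivialLocus_classPullback_whiskerLeft (X ⊗ Y) j (by rw [ht']; exact ht)
  -- Step 2: `D₁` comes from a stage `t₀` of `(P ⊗ Spec B).left = lim (P ⊗ Spec K[t]).left`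
  haveI : Quiver.IsThin (Idx B (∅ : Finset B))ᵒᵖ := fun _ _ => ⟨fun f g => hom_eq f g⟩
  haveI : IsIntegral (prodCone K B (∅ : Finset B) (X ⊗ Y)).pt :=
    ‹IsIntegral ((X ⊗ Y) ⊗ specOver K B).left›
  haveI : IsIntegral (prodCone K B (∅ : Finset B) Y).pt := ‹IsIntegral (Y ⊗ specOver K B).left›
  haveI : IsIntegral (prodCone K B (∅ : Finset B) X).pt := ‹IsIntegral (X ⊗ specOver K B).left›
  obtain ⟨t₀, E₀, hE₀⟩ := exists_sameDivisor_pullback_π (prodDiagram K B ∅ (X ⊗ Y))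
    (prodCone K B ∅ (X ⊗ Y)) (isLimitProdCone K B ∅ (X ⊗ Y)) D₁
  -- notation for the stages, and integrality of the stage products (GW I, Prop. 5.51 (ii))
  let Tst : (Idx B (∅ : Finset B))ᵒᵖ → SchemeOver K := fun s => (baseDiagram K B ∅).obj s
  let π : ∀ s, specOver K B ⟶ Tst s := fun s => (baseCone K B ∅).π.app s
  let β : ∀ {s s' : (Idx B (∅ : Finset B))ᵒᵖ}, (s ⟶ s') → (Tst s ⟶ Tst s') :=
    fun f => (baseDiagram K B ∅).map f
  have iP : ∀ s, IsIntegral ((X ⊗ Y) ⊗ Tst s).left := fun s =>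
    SubalgApprox.isIntegral_prodDiagram_obj B ∅ (X ⊗ Y) s
  have iY : ∀ s, IsIntegral (Y ⊗ Tst s).left := fun s =>
    SubalgApprox.isIntegral_prodDiagram_obj B ∅ Y s
  have iX : ∀ s, IsIntegral (X ⊗ Tst s).left := fun s =>
    SubalgApprox.isIntegral_prodDiagram_obj B ∅ X s
  haveI := iP t₀; haveI := iY t₀; haveI := iX t₀
  have hrel : D₁.LinEquiv (E₀.classPullback ((X ⊗ Y) ◁ π t₀).left) :=
    hE₀.linEquiv.trans (E₀.classPullback_linEquiv_pullback _).symm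
  -- Step 3: the slices of `E₀` die on finer stages `t₁`, `t₂`
  have hSY : ((E₀.classPullback (fY ▷ Tst t₀).left).pullback
      (proj (prodDiagram K B ∅ Y) (prodCone K B ∅ Y) t₀)).LinEquiv 0 :=
    (CartierDivisor.classPullback_linEquiv_pullback _ _).symm.trans
      (linEquiv_zero_classPullback_slice_whiskerLeft (X ⊗ Y) fY (π t₀) hrel hx₁)
  obtain ⟨t₁, f₁, hY₁⟩ := exists_linEquiv_zero_pullback_map (prodDiagram K B ∅ Y)
    (prodCone K B ∅ Y) (isLimitProdCone K B ∅ Y) _ hSY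
  have hSX : ((E₀.classPullback (fX ▷ Tst t₀).left).pullback
      (proj (prodDiagram K B ∅ X) (prodCone K B ∅ X) t₀)).LinEquiv 0 :=
    (CartierDivisor.classPullback_linEquiv_pullback _ _).symm.trans
      (linEquiv_zero_classPullback_slice_whiskerLeft (X ⊗ Y) fX (π t₀) hrel hy₁)
  obtain ⟨t₂, f₂, hX₂⟩ := exists_linEquiv_zero_pullback_map (prodDiagram K B ∅ X)
    (prodCone K B ∅ X) (isLimitProdCone K B ∅ X) _ hSX
  -- Step 4: the fibre condition dies on a finer stage `t₃`
  have ht₀ : t' ∈ CartierDivisor.trivialLocus (X ⊗ Y) (specOver K B)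
      (E₀.pullback (leg B ∅ (X ⊗ Y) t₀)) := by
    rw [← hE₀.linEquiv.trivialLocus_eq]; exact ht₁
  obtain ⟨t₃, f₃, hZ₃⟩ := hfib K (X ⊗ Y) B ∅ t₀ E₀ t' ht₀
  -- Step 5: a common refinement `t₄`
  obtain ⟨t₄, ht₄⟩ := exists_hom_of_finite B (∅ : Finset B) ![t₁, t₂, t₃]
  have g₁ : t₄ ⟶ t₁ := (ht₄ 0).some
  have g₂ : t₄ ⟶ t₂ := (ht₄ 1).some
  have g₃ : t₄ ⟶ t₃ := (ht₄ 2).some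
  haveI := iP t₁; haveI := iP t₂; haveI := iP t₃; haveI := iP t₄
  haveI := iY t₁; haveI := iY t₄; haveI := iX t₂; haveI := iX t₄
  let F : t₄ ⟶ t₀ := g₁ ≫ f₁
  have hF₂ : F = g₂ ≫ f₂ := hom_eq _ _
  have hF₃ : F = g₃ ≫ f₃ := hom_eq _ _
  let D₀ : CartierDivisor ((prodDiagram K B ∅ (X ⊗ Y)).obj t₄) :=
    E₀.pullback ((prodDiagram K B ∅ (X ⊗ Y)).map F)
  have hD₀ : D₀.LinEquiv (E₀.classPullback ((X ⊗ Y) ◁ β F).left) :=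
    (E₀.classPullback_linEquiv_pullback _).symm
  -- `(D F)^* E₀ ∼ (P × β g)^* (P × β f)^* E₀` whenever `F = g ≫ f`
  have hcomp : ∀ {s : (Idx B (∅ : Finset B))ᵒᵖ} (g : t₄ ⟶ s) (f : s ⟶ t₀), F = g ≫ f →
      [IsIntegral ((X ⊗ Y) ⊗ Tst s).left] →
      D₀.LinEquiv ((E₀.classPullback ((X ⊗ Y) ◁ β f).left).classPullback
        ((X ⊗ Y) ◁ β g).left) := by
    intro s g f hFgf _
    refine hD₀.trans ?_
    have e : ((X ⊗ Y) ◁ β F).left = ((X ⊗ Y) ◁ (β g ≫ β f)).left := by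
      change ((X ⊗ Y) ◁ (baseDiagram K B ∅).map F).left =
        ((X ⊗ Y) ◁ ((baseDiagram K B ∅).map g ≫ (baseDiagram K B ∅).map f)).left
      rw [hFgf, Functor.map_comp]
    rw [CartierDivisor.classPullback_congr e]
    exact CartierDivisor.classPullback_whiskerLeft_comp_linEquiv' (X ⊗ Y) (β f) (β g) E₀
  refine ⟨specOver K B, j, hj, t', ht', Tst t₄, inferInstance, inferInstance, inferInstance, iP t₄,
    iY t₄, iX t₄, π t₄, inferInstance, D₀, ?_, ?_, ?_, ?_⟩
  · -- (i) `D₁ ∼ (P × φ)^* D₀`: `π_{t₀} = π_{t₄} ≫ (D F)`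
    have hw : leg B ∅ (X ⊗ Y) t₀ = leg B ∅ (X ⊗ Y) t₄ ≫ (prodDiagram K B ∅ (X ⊗ Y)).map F :=
      ((prodCone K B ∅ (X ⊗ Y)).w F).symm
    refine hE₀.linEquiv.trans ?_
    refine (((E₀.pullback_congr_sameDivisor hw).trans
      (E₀.pullback_pullback_sameDivisor _ _).symm).linEquiv).trans ?_
    exact (D₀.classPullback_linEquiv_pullback _).symm
  · -- (ii) the `Y`-slice of `D₀`
    have h1 : ((E₀.classPullback ((X ⊗ Y) ◁ β f₁).left).classPullback
        (fY ▷ Tst t₁).left).LinEquiv 0 :=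
      linEquiv_zero_slice_classPullback_whiskerLeft (X ⊗ Y) fY (β f₁)
        (((E₀.classPullback (fY ▷ Tst t₀).left).classPullback_linEquiv_pullback _).trans hY₁)
    have h2 := CartierDivisor.linEquiv_zero_classPullback_whiskerRight_whiskerLeft (X ⊗ Y)
      (β g₁) fY h1
    exact ((hcomp g₁ f₁ rfl).classPullback _).trans h2
  · -- (iii) the `X`-slice of `D₀`
    have h1 : ((E₀.classPullback ((X ⊗ Y) ◁ β f₂).left).classPullback
        (fX ▷ Tst t₂).left).LinEquiv 0 :=
      linEquiv_zero_slice_classPullback_whiskerLeft (X ⊗ Y) fX (β f₂)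
        (((E₀.classPullback (fX ▷ Tst t₀).left).classPullback_linEquiv_pullback _).trans hX₂)
    have h2 := CartierDivisor.linEquiv_zero_classPullback_whiskerRight_whiskerLeft (X ⊗ Y)
      (β g₂) fX h1
    exact ((hcomp g₂ f₂ hF₂).classPullback _).trans h2
  · -- (iv) the fibre condition at `φ(t') = π_{t₄}(t')`: base change from `t₃` along `β g₃`
    have hpt : ((baseCone K B ∅).π.app t₃).left t' = (β g₃).left ((π t₄).left t') := by
      rw [← Scheme.Hom.comp_apply, ← Over.comp_left, (baseCone K B ∅).w g₃]
      rfl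
    rw [hpt] at hZ₃
    have h4 := CartierDivisor.mem_trivialLocus_classPullback_whiskerLeft (X ⊗ Y) (β g₃) hZ₃
    have h5 : D₀.LinEquiv (((E₀.pullback ((prodDiagram K B ∅ (X ⊗ Y)).map f₃)).classPullback
        ((X ⊗ Y) ◁ β g₃).left)) :=
      (hcomp g₃ f₃ hF₃).trans ((E₀.classPullback_linEquiv_pullback _).classPullback _)
    rw [h5.trivialLocus_eq]
    exact h4

/-- **The trust base of `theoremOfCube_isTrivialOver_nhds` (Lemma 24.72 for `𝒪(D)` over a general
integral base, `Motives/TheoremOfCubeLocal`) after this file**: Step (I)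
(`theoremOfCube_trivialAlong_thickeningPt`), the theorem on formal functions for `H⁰` of `𝒪(D)`
(`formalFunctions_exists_isSectionOver_restrict`) and the descent of the fibre condition along the
stages (`trivialLocus_descendsAlongStages`): the locally noetherian case from the first two
(`theoremOfCube_isTrivialOver_nhds_locallyNoetherian_of_cube_stepI_of_formalFunctions`) and the
general base by descent (`theoremOfCube_isTrivialOver_nhds_of_locallyNoetherian_of_descent`,
`Motives/TheoremOfCubeLimit`).
[cite: GortzWedhorn2023, Lemma 24.72, proof (pp. 548–549), with Thm. 23.133, Step (IV) (p. 479)] -/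
theorem theoremOfCube_isTrivialOver_nhds_of_cube_stepI_of_formalFunctions_of_fibre
    (HI : theoremOfCube_trivialAlong_thickeningPt.{u})
    (HF : formalFunctions_exists_isSectionOver_restrict.{u})
    (hfib : trivialLocus_descendsAlongStages.{u}) : theoremOfCube_isTrivialOver_nhds.{u} :=
  theoremOfCube_isTrivialOver_nhds_of_locallyNoetherian_of_descent
    (theoremOfCube_isTrivialOver_nhds_locallyNoetherian_of_cube_stepI_of_formalFunctions HI HF)
    (theoremOfCube_noetherianDescent_of_trivialLocus_descends hfib)

/-- The descent fact follows from the descent of the fibre condition. [folklore] -/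
theorem theoremOfCube_noetherianDescent_of_fibre (hfib : trivialLocus_descendsAlongStages.{u}) :
    theoremOfCube_noetherianDescent.{u} :=
  theoremOfCube_noetherianDescent_of_trivialLocus_descends hfib

end Literature.AlgebraicGeometry.Motives

end

/-! ## Part II. The limit presentation of the fibre `P_{κ(t')} = lim_t P_{κ(t'_t)}` and the
## discharge of `trivialLocus_descendsAlongStages`

For a point `𝔮 = t'` of `Spec B` and a `K`-subalgebra `S ⊆ B`, the image `𝔮_S` of `𝔮` in `Spec S`
is the prime `𝔮 ∩ S` (`ResidueFieldApprox.under`), with residue field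
`κ(𝔮 ∩ S) = Frac(S/𝔮 ∩ S)` (Mathlib `Ideal.ResidueField`); for `S ≤ T` there are `K`-algebra maps
`κ(𝔮 ∩ S) → κ(𝔮 ∩ T) → κ(𝔮)` (`κMap`, `κTo`, Mathlib `Ideal.ResidueField.mapₐ`). Over the
finitely generated subalgebras `K[t] ⊆ B`, `t ⊇ s₁` finite (`Limits/SubalgebraDiagram`), this is a
filtered diagram of fields with colimit `κ(𝔮)` (`isColimitFibRingCocone`: every element of
`Frac(B/𝔮)` is a quotient of residues of two elements of `B`), hence
`Spec κ(𝔮) = lim_t Spec κ(𝔮 ∩ K[t])` and, fibre products commuting with cofiltered limits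
(`isLimitTensorLeftCone`, proved from the universal property of `P ×_K -`),
`(P ⊗ Spec κ(𝔮)).left = lim_t (P ⊗ Spec κ(𝔮 ∩ K[t])).left` (`isLimitFibCone`) — a cofiltered
limit of integral schemes (`P` geometrically integral) with affine surjective transition maps and
surjective projections. The comparison with the fibres `P ⊗ residuePt` of `Motives/SeesawTheorem`
is through Mathlib's `Scheme.Spec.residueFieldIso` (`eHom`, `eBHom`, `eHom_jHom`, `εHom_eq`), and
`trivialLocus_descendsAlongStages_holds` follows from `exists_linEquiv_zero_pullback_map`
(`Limits/CartierDivisorLinEquiv`) by moving divisor classes along the commutative squares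
`legF_jHom`, `mapF_jHom` (Görtz–Wedhorn I, (10.13); The Stacks Project, Tags 01YT, 01ZR, 0B8W).
Mathlib searched (pin): `Ideal.ResidueField`, `Ideal.ResidueField.mapₐ`,
`Ideal.ResidueField.map_algebraMap`, `Ideal.ResidueField.algHom_ext`,
`IsFractionRing (R ⧸ I) I.ResidueField`, `IsFractionRing.div_surjective`,
`Scheme.Spec.residueFieldIso`, `Scheme.Spec.map_residueFieldIso_inv_eq_fromSpecResidueField`,
`Types.FilteredColimit.isColimitOf'`, `GeometricallyIntegral.geometrically_isIntegral` (used);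
Mathlib has no presentation of the residue field of a limit as a colimit of residue fields.
-/

open Opposite

noncomputable section

namespace Literature.AlgebraicGeometry.Motives

set_option backward.isDefEq.respectTransparency false

/-! ### `Spec` of a `K`-algebra homomorphism as a morphism of `K`-schemes -/

section SpecOverMap

variable {K : Type u} [CommRing K] {R S : Type u} [CommRing R] [CommRing S] [Algebra K R]
  [Algebra K S]

/-- `Spec φ : Spec S → Spec R` over `Spec K`, for a `K`-algebra homomorphism `φ : R → S`.
[folklore] -/
def specOverOfAlgHom (φ : R →ₐ[K] S) : specOver K S ⟶ specOver K R :=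
  Over.homMk (Spec.map (CommRingCat.ofHom φ.toRingHom)) (by
    change Spec.map _ ≫ Spec.map _ = Spec.map _
    rw [← Spec.map_comp, ← CommRingCat.ofHom_comp]
    exact congrArg (fun g => Spec.map (CommRingCat.ofHom g)) (RingHom.ext fun r => φ.commutes r))

/-- The underlying morphism of schemes of `specOverOfAlgHom φ` (by `rfl`). [folklore] -/
@[simp] theorem specOverOfAlgHom_left (φ : R →ₐ[K] S) :
    (specOverOfAlgHom φ).left = Spec.map (CommRingCat.ofHom φ.toRingHom) := rfl

end SpecOverMap

/-! ### `(P ⊗ -).left` preserves the limits of `K`-schemes computed in `Scheme` -/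

section TensorLeftLimit

variable {K : Type u} [CommRing K] {J : Type u} [SmallCategory J]
  (P : SchemeOver K) {F : J ⥤ SchemeOver K} (c : Cone F)
  (hc : IsLimit ((Over.forget _).mapCone c))

/-- The cone `(P ⊗ c.pt).left → (P ⊗ F j).left`. [folklore] -/
abbrev tensorLeftCone : Cone (F ⋙ tensorLeft P ⋙ Over.forget _) :=
  (tensorLeft P ⋙ Over.forget _).mapCone c

namespace TensorLeftLimit

variable {P c}

/-- The second components of the legs of a cone over `j ↦ (P ⊗ F j).left` form a cone over the
`(F j).left`. [folklore] -/
def secondCone (s : Cone (F ⋙ tensorLeft P ⋙ Over.forget _)) : Cone (F ⋙ Over.forget _) where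
  pt := s.pt
  π := { app j := s.π.app j ≫ pullback.snd _ _
         naturality j j' f := by
           change 𝟙 _ ≫ s.π.app j' ≫ pullback.snd _ _ =
             (s.π.app j ≫ pullback.snd _ _) ≫ (F.map f).left
           rw [Category.id_comp, ← s.w f, Category.assoc, Category.assoc]
           change s.π.app j ≫ (P ◁ F.map f).left ≫ pullback.snd _ _ = _
           rw [Over.whiskerLeft_left_snd] }

/-- The induced morphism to `c.pt.left` is compatible with the legs. [folklore] -/
@[reassoc]
theorem lift_secondCone_π (s : Cone (F ⋙ tensorLeft P ⋙ Over.forget _)) (j : J) :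
    hc.lift (secondCone s) ≫ (c.π.app j).left = s.π.app j ≫ pullback.snd _ _ :=
  hc.fac (secondCone s) j

variable [IsCofiltered J]

/-- All legs of a cone over `j ↦ (P ⊗ F j).left` have the same first component. [folklore] -/
theorem legs_fst_eq (s : Cone (F ⋙ tensorLeft P ⋙ Over.forget _)) (j j' : J) :
    s.π.app j ≫ pullback.fst _ _ = s.π.app j' ≫ pullback.fst _ _ := by
  rw [← s.w (IsCofiltered.minToLeft j j'), ← s.w (IsCofiltered.minToRight j j'), Category.assoc,
    Category.assoc]
  change s.π.app _ ≫ (P ◁ F.map _).left ≫ pullback.fst _ _ =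
    s.π.app _ ≫ (P ◁ F.map _).left ≫ pullback.fst _ _
  rw [Over.whiskerLeft_left_fst, Over.whiskerLeft_left_fst]

/-- An index (the cofiltered category `J` is non-empty). [folklore] -/
def someIdx : J := (IsCofiltered.nonempty (C := J)).some

/-- The (common) first component of the legs of a cone over `j ↦ (P ⊗ F j).left`. [folklore] -/
def firstComp (s : Cone (F ⋙ tensorLeft P ⋙ Over.forget _)) : s.pt ⟶ P.left :=
  s.π.app someIdx ≫ pullback.fst _ _

/-- `firstComp` is the first component of every leg. [folklore] -/
theorem firstComp_eq (s : Cone (F ⋙ tensorLeft P ⋙ Over.forget _)) (j : J) :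
    firstComp s = s.π.app j ≫ pullback.fst _ _ :=
  legs_fst_eq s _ _

/-- The two components of a cone over `j ↦ (P ⊗ F j).left` agree over `Spec K`. [folklore] -/
theorem firstComp_comp_hom (s : Cone (F ⋙ tensorLeft P ⋙ Over.forget _)) :
    firstComp s ≫ P.hom = hc.lift (secondCone s) ≫ c.pt.hom := by
  have h1 : firstComp s ≫ P.hom = (s.π.app someIdx ≫ pullback.snd _ _) ≫ (F.obj someIdx).hom := by
    rw [firstComp, Category.assoc, pullback.condition, Category.assoc]
  rw [h1, ← lift_secondCone_π hc, Category.assoc, Over.w]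
  rfl

/-- The lift of a cone over `j ↦ (P ⊗ F j).left` to `(P ⊗ c.pt).left`. [folklore] -/
def lift (s : Cone (F ⋙ tensorLeft P ⋙ Over.forget _)) : s.pt ⟶ (tensorLeftCone P c).pt :=
  pullback.lift (firstComp s) (hc.lift (secondCone s)) (firstComp_comp_hom hc s)

end TensorLeftLimit

open TensorLeftLimit in
/-- **`(P ⊗ lim_j F j).left = lim_j (P ⊗ F j).left`**: if a cone `c` of `K`-schemes over a
cofiltered diagram is a limit cone in `Scheme`, then so is `(P ⊗ c).left` (fibre products commute
with cofiltered limits; Görtz–Wedhorn I, (10.13): "`X ×_{S₀} S` is the limit of the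
`X ×_{S₀} S_λ`"). [cite: GortzWedhorn2020, (10.13), p. 321] -/
def isLimitTensorLeftCone [IsCofiltered J] : IsLimit (tensorLeftCone P c) where
  lift s := TensorLeftLimit.lift hc s
  fac s j := by
    apply pullback.hom_ext
    · change (TensorLeftLimit.lift hc s ≫ (P ◁ c.π.app j).left) ≫ pullback.fst _ _ =
        s.π.app j ≫ pullback.fst _ _
      rw [Category.assoc, Over.whiskerLeft_left_fst]
      exact (pullback.lift_fst _ _ _).trans (firstComp_eq s j)
    · change (TensorLeftLimit.lift hc s ≫ (P ◁ c.π.app j).left) ≫ pullback.snd _ _ =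
        s.π.app j ≫ pullback.snd _ _
      rw [Category.assoc, Over.whiskerLeft_left_snd]
      exact (pullback.lift_snd_assoc _ _ _ _).trans (lift_secondCone_π hc s j)
  uniq s m hm := by
    apply pullback.hom_ext
    · refine Eq.trans ?_ (pullback.lift_fst _ _ _).symm
      rw [firstComp_eq s someIdx]
      change m ≫ pullback.fst _ _ = s.π.app someIdx ≫ pullback.fst _ _
      rw [← hm someIdx]
      change _ = (m ≫ (P ◁ c.π.app someIdx).left) ≫ pullback.fst _ _
      rw [Category.assoc, Over.whiskerLeft_left_fst]
      rfl
    · refine Eq.trans ?_ (pullback.lift_snd _ _ _).symm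
      refine hc.uniq (secondCone s) (m ≫ pullback.snd _ _) fun j => ?_
      change (m ≫ pullback.snd _ _) ≫ (c.π.app j).left = s.π.app j ≫ pullback.snd _ _
      rw [← hm j]
      change (m ≫ pullback.snd _ _) ≫ (c.π.app j).left =
        (m ≫ (P ◁ c.π.app j).left) ≫ pullback.snd _ _
      rw [Category.assoc, Category.assoc, Over.whiskerLeft_left_snd]
      rfl

end TensorLeftLimit

/-! ### The residue fields `κ(𝔮 ∩ S)` of a point `𝔮 ∈ Spec B` on the subalgebras `S ⊆ B` -/

namespace ResidueFieldApprox

section Generic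

variable {K B : Type u} [Field K] [CommRing B] [Algebra K B] (q : PrimeSpectrum B)

/-- The prime `𝔮 ∩ S` of a `K`-subalgebra `S ⊆ B` below the point `𝔮 ∈ Spec B` — the image
`𝔮_S ∈ Spec S` of `𝔮`. [folklore] -/
abbrev under (S : Subalgebra K B) : Ideal S := q.asIdeal.comap S.val.toRingHom

/-- `𝔮 ∩ S` is the preimage of `𝔮 ∩ T` for `S ≤ T`. [folklore] -/
theorem under_eq_comap {S T : Subalgebra K B} (h : S ≤ T) :
    under q S = (under q T).comap (Subalgebra.inclusion h).toRingHom := by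
  ext x
  simp only [Ideal.mem_comap, AlgHom.toRingHom_eq_coe, RingHom.coe_coe, Subalgebra.coe_val,
    Subalgebra.coe_inclusion]

/-- The residue field `κ(𝔮_S) = κ(𝔮 ∩ S) = Frac(S/𝔮 ∩ S)` of `Spec S` at the image of `𝔮`
(Mathlib `Ideal.ResidueField`). [folklore] -/
abbrev κ (S : Subalgebra K B) : Type u := (under q S).ResidueField

/-- The inclusion `κ(𝔮 ∩ S) → κ(𝔮 ∩ T)` for `S ≤ T`. [folklore] -/
def κMap {S T : Subalgebra K B} (h : S ≤ T) : κ q S →ₐ[K] κ q T :=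
  Ideal.ResidueField.mapₐ _ _ (Subalgebra.inclusion h) (under_eq_comap q h)

/-- The inclusion `κ(𝔮 ∩ S) → κ(𝔮)`. [folklore] -/
def κTo (S : Subalgebra K B) : κ q S →ₐ[K] q.asIdeal.ResidueField :=
  Ideal.ResidueField.mapₐ _ _ S.val rfl

/-- `κ(𝔮 ∩ S) → κ(𝔮 ∩ T)` on residues of elements of `S`. [folklore] -/
theorem κMap_algebraMap {S T : Subalgebra K B} (h : S ≤ T) (x : S) :
    κMap q h (algebraMap S (κ q S) x) = algebraMap T (κ q T) (Subalgebra.inclusion h x) :=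
  Ideal.ResidueField.map_algebraMap _ _ _ _ x

/-- `κ(𝔮 ∩ S) → κ(𝔮)` on residues of elements of `S`. [folklore] -/
theorem κTo_algebraMap (S : Subalgebra K B) (x : S) :
    κTo q S (algebraMap S (κ q S) x) = algebraMap B q.asIdeal.ResidueField (x : B) :=
  Ideal.ResidueField.map_algebraMap _ _ _ _ x

/-- `κ(𝔮 ∩ S) → κ(𝔮 ∩ S)` is the identity. [folklore] -/
theorem κMap_self {S : Subalgebra K B} (h : S ≤ S) : κMap q h = AlgHom.id K _ := by
  apply Ideal.ResidueField.algHom_ext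
  ext x
  change κMap q h (algebraMap S (κ q S) x) = algebraMap S (κ q S) x
  rw [κMap_algebraMap]
  exact congrArg _ (Subtype.ext (Subalgebra.coe_inclusion _ x))

/-- The inclusions `κ(𝔮 ∩ S) → κ(𝔮 ∩ T) → κ(𝔮 ∩ U)` compose. [folklore] -/
theorem κMap_comp {S T U : Subalgebra K B} (h₁ : S ≤ T) (h₂ : T ≤ U) (h₃ : S ≤ U) :
    (κMap q h₂).comp (κMap q h₁) = κMap q h₃ := by
  apply Ideal.ResidueField.algHom_ext
  ext x
  change κMap q h₂ (κMap q h₁ (algebraMap S (κ q S) x)) = κMap q h₃ (algebraMap S (κ q S) x)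
  rw [κMap_algebraMap, κMap_algebraMap, κMap_algebraMap, Subalgebra.inclusion_inclusion]

/-- The inclusions `κ(𝔮 ∩ S) → κ(𝔮 ∩ T) → κ(𝔮)` compose. [folklore] -/
theorem κTo_comp_κMap {S T : Subalgebra K B} (h : S ≤ T) :
    (κTo q T).comp (κMap q h) = κTo q S := by
  apply Ideal.ResidueField.algHom_ext
  ext x
  change κTo q T (κMap q h (algebraMap S (κ q S) x)) = κTo q S (algebraMap S (κ q S) x)
  rw [κMap_algebraMap, κTo_algebraMap, κTo_algebraMap, Subalgebra.coe_inclusion]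

/-- `κMap` along `S ≤ S` is the identity, in `CommRingCat`. [folklore] -/
theorem ofHom_κMap_self {S : Subalgebra K B} (h : S ≤ S) :
    CommRingCat.ofHom (κMap q h).toRingHom = 𝟙 (CommRingCat.of (κ q S)) := by
  rw [κMap_self]
  rfl

/-- `κMap` is transitive, in `CommRingCat`. [folklore] -/
theorem ofHom_κMap_comp {S T U : Subalgebra K B} (h₁ : S ≤ T) (h₂ : T ≤ U) (h₃ : S ≤ U) :
    CommRingCat.ofHom (κMap q h₃).toRingHom =
      CommRingCat.ofHom (κMap q h₁).toRingHom ≫ CommRingCat.ofHom (κMap q h₂).toRingHom := by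
  rw [← κMap_comp q h₁ h₂ h₃]
  rfl

/-- `κMap` followed by `κTo` is `κTo`, in `CommRingCat`. [folklore] -/
theorem ofHom_κMap_κTo {S T : Subalgebra K B} (h : S ≤ T) :
    CommRingCat.ofHom (κMap q h).toRingHom ≫ CommRingCat.ofHom (κTo q T).toRingHom =
      CommRingCat.ofHom (κTo q S).toRingHom := by
  rw [← κTo_comp_κMap q h]
  rfl

/-! #### The comparison morphisms of `K`-schemes -/

/-- `Spec κ(𝔮 ∩ S) → Spec S` over `Spec K`. [folklore] -/
def jHom (S : Subalgebra K B) : specOver K (κ q S) ⟶ specOver K S :=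
  specOverOfAlgHom (IsScalarTower.toAlgHom K S (κ q S))

/-- `Spec κ(𝔮) → Spec B` over `Spec K`. [folklore] -/
def εHom : specOver K q.asIdeal.ResidueField ⟶ specOver K B :=
  specOverOfAlgHom (IsScalarTower.toAlgHom K B q.asIdeal.ResidueField)

/-- **`Spec κ(𝔮 ∩ T) → Spec κ(𝔮 ∩ S) → Spec S` is `Spec κ(𝔮 ∩ T) → Spec T → Spec S`** for
`S ≤ T`. [folklore] -/
theorem κMap_jHom {S T : Subalgebra K B} (h : S ≤ T) :
    specOverOfAlgHom (κMap q h) ≫ jHom q S = jHom q T ≫ specOverOfAlgHom (Subalgebra.inclusion h) := by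
  ext : 1
  change Spec.map (CommRingCat.ofHom (κMap q h).toRingHom) ≫
      Spec.map (CommRingCat.ofHom (IsScalarTower.toAlgHom K S (κ q S)).toRingHom) =
    Spec.map (CommRingCat.ofHom (IsScalarTower.toAlgHom K T (κ q T)).toRingHom) ≫
      Spec.map (CommRingCat.ofHom (Subalgebra.inclusion h).toRingHom)
  rw [← Spec.map_comp, ← Spec.map_comp, ← CommRingCat.ofHom_comp, ← CommRingCat.ofHom_comp]
  exact congrArg (fun g => Spec.map (CommRingCat.ofHom g))
    (RingHom.ext fun x => κMap_algebraMap q h x)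

/-- **`Spec κ(𝔮) → Spec κ(𝔮 ∩ S) → Spec S` is `Spec κ(𝔮) → Spec B → Spec S`.** [folklore] -/
theorem κTo_jHom (S : Subalgebra K B) :
    specOverOfAlgHom (κTo q S) ≫ jHom q S = εHom q ≫ specOverOfAlgHom S.val := by
  ext : 1
  change Spec.map (CommRingCat.ofHom (κTo q S).toRingHom) ≫
      Spec.map (CommRingCat.ofHom (IsScalarTower.toAlgHom K S (κ q S)).toRingHom) =
    Spec.map (CommRingCat.ofHom (IsScalarTower.toAlgHom K B q.asIdeal.ResidueField).toRingHom) ≫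
      Spec.map (CommRingCat.ofHom S.val.toRingHom)
  rw [← Spec.map_comp, ← Spec.map_comp, ← CommRingCat.ofHom_comp, ← CommRingCat.ofHom_comp]
  exact congrArg (fun g => Spec.map (CommRingCat.ofHom g))
    (RingHom.ext fun x => κTo_algebraMap q S x)

/-- The image `𝔮_S ∈ Spec S` of `𝔮` under `Spec B → Spec S`. [folklore] -/
abbrev pt (S : Subalgebra K B) : ↥(Spec (CommRingCat.of S)) :=
  Spec.map (CommRingCat.ofHom S.val.toRingHom) q

/-- **`Spec κ(𝔮_S) → Spec κ(𝔮 ∩ S)`**, the (inverse of the) identification of the residue field of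
the scheme `Spec S` at `𝔮_S` with `κ(𝔮 ∩ S)` (Mathlib `Scheme.Spec.residueFieldIso`), as a morphism of
`K`-schemes. [folklore] -/
def eHom (S : Subalgebra K B) : residuePt (specOver K S) (pt q S) ⟶ specOver K (κ q S) :=
  Over.homMk (Spec.map (Scheme.Spec.residueFieldIso (CommRingCat.of S) (pt q S)).inv) (by
    change Spec.map _ ≫ Spec.map (CommRingCat.ofHom (algebraMap K (κ q S))) =
      ((Spec (CommRingCat.of S)).fromSpecResidueField (pt q S)) ≫
        Spec.map (CommRingCat.ofHom (algebraMap K S))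
    rw [← Scheme.Spec.map_residueFieldIso_inv_eq_fromSpecResidueField, Category.assoc,
      ← Spec.map_comp (CommRingCat.ofHom (algebraMap K S)), ← CommRingCat.ofHom_comp]
    exact congrArg (fun g => Spec.map _ ≫ Spec.map (CommRingCat.ofHom g))
      (IsScalarTower.algebraMap_eq K S (κ q S)))

/-- **The fibre inclusion `Spec κ(𝔮_S) → Spec S` factors as `Spec κ(𝔮_S) → Spec κ(𝔮 ∩ S) → Spec S`.**
[folklore] -/
theorem eHom_jHom (S : Subalgebra K B) :
    residuePtι (specOver K S) (pt q S) = eHom q S ≫ jHom q S := by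
  ext : 1
  change (Spec (CommRingCat.of S)).fromSpecResidueField (pt q S) =
    Spec.map (Scheme.Spec.residueFieldIso (CommRingCat.of S) (pt q S)).inv ≫
      Spec.map (CommRingCat.ofHom (IsScalarTower.toAlgHom K S (κ q S)).toRingHom)
  exact (Scheme.Spec.map_residueFieldIso_inv_eq_fromSpecResidueField _ _).symm

/-- **`Spec κ(𝔮) → Spec κ(point 𝔮 of Spec B)`**, the identification of `κ(𝔮) = Frac(B/𝔮)` with
the residue field of the scheme `Spec B` at `𝔮` (Mathlib `Scheme.Spec.residueFieldIso`), as a morphism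
of `K`-schemes. [folklore] -/
def eBHom : specOver K q.asIdeal.ResidueField ⟶ residuePt (specOver K B) q :=
  Over.homMk (Spec.map (Scheme.Spec.residueFieldIso (CommRingCat.of B) q).hom) (by
    change Spec.map _ ≫ (Spec (CommRingCat.of B)).fromSpecResidueField q ≫
        Spec.map (CommRingCat.ofHom (algebraMap K B)) =
      Spec.map (CommRingCat.ofHom (algebraMap K q.asIdeal.ResidueField))
    rw [← Scheme.Spec.map_residueFieldIso_inv_eq_fromSpecResidueField, ← Category.assoc,
      ← Category.assoc, ← Spec.map_comp, Iso.inv_hom_id, Spec.map_id, Category.id_comp,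
      ← Spec.map_comp, ← CommRingCat.ofHom_comp]
    exact congrArg (fun g => Spec.map (CommRingCat.ofHom g))
      (IsScalarTower.algebraMap_eq K B q.asIdeal.ResidueField).symm)

/-- **`Spec κ(𝔮) → Spec B` is the fibre inclusion of `Spec B` at `𝔮`** (up to the identification
`eBHom`). [folklore] -/
theorem εHom_eq : εHom q = eBHom q ≫ residuePtι (specOver K B) q := by
  ext : 1
  change Spec.map (CommRingCat.ofHom
      (IsScalarTower.toAlgHom K B q.asIdeal.ResidueField).toRingHom) =
    Spec.map (Scheme.Spec.residueFieldIso (CommRingCat.of B) q).hom ≫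
      (Spec (CommRingCat.of B)).fromSpecResidueField q
  rw [← Scheme.Spec.map_residueFieldIso_inv_eq_fromSpecResidueField, ← Category.assoc, ← Spec.map_comp,
    Iso.inv_hom_id, Spec.map_id, Category.id_comp]
  rfl

/-- `(P ⊗ Spec F).left = P ×_K Spec F` is integral for a field extension `F` of `K` and `P`
geometrically integral over `K`. [folklore] -/
instance isIntegral_tensorObj_specOver_left (P : SchemeOver K) [GeometricallyIntegral P.hom]
    (F : Type u) [Field F] [Algebra K F] : IsIntegral (P ⊗ specOver K F).left :=
  GeometricallyIntegral.geometrically_isIntegral (f := P.hom) (specOver K F).hom _ _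
    (IsPullback.of_hasPullback P.hom (specOver K F).hom)

end Generic

/-- Equal divisors are linearly equivalent. [folklore] -/
theorem _root_.Literature.AlgebraicGeometry.Motives.CartierDivisor.LinEquiv.of_eq {X : Scheme.{u}}
    [IsIntegral X] {D E : CartierDivisor X} (h : D = E) : D.LinEquiv E :=
  h ▸ CartierDivisor.LinEquiv.refl D

/-! ### The diagram `t ↦ κ(𝔮 ∩ K[t])` and its colimit `κ(𝔮)` -/

section Diagram

open Literature.AlgebraicGeometry.Limits.SubalgApprox (Idx sub sub_mono)

variable (K B : Type u) [Field K] [CommRing B] [Algebra K B] (s₁ : Finset B) (q : PrimeSpectrum B)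

/-- The filtered diagram `t ↦ κ(𝔮 ∩ K[t])`. [folklore] -/
def fibRingDiagram : Idx B s₁ ⥤ CommRingCat.{u} where
  obj t := CommRingCat.of (κ q (sub K B t.1))
  map f := CommRingCat.ofHom (κMap q (sub_mono (K := K) f.le)).toRingHom
  map_id _ := ofHom_κMap_self q _
  map_comp _ _ := ofHom_κMap_comp q _ _ _

/-- The cocone of inclusions `κ(𝔮 ∩ K[t]) → κ(𝔮)`. [folklore] -/
def fibRingCocone : Cocone (fibRingDiagram K B s₁ q) where
  pt := CommRingCat.of q.asIdeal.ResidueField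
  ι := { app t := CommRingCat.ofHom (κTo q (sub K B t.1)).toRingHom
         naturality _ _ _ := (ofHom_κMap_κTo q _).trans (Category.comp_id _).symm }

/-- **`κ(𝔮)` is the directed union of the `κ(𝔮 ∩ K[t])`**: every element of
`κ(𝔮) = Frac(B/𝔮)` is a quotient `a/s` of residues of elements of `B`, which lies in
`κ(𝔮 ∩ K[t])` as soon as `a, s ∈ t`; and the maps `κ(𝔮 ∩ K[t]) → κ(𝔮)` are injective.
[folklore] -/
def isColimitFibRingCocone : IsColimit (fibRingCocone K B s₁ q) := by
  haveI : ReflectsColimit (fibRingDiagram K B s₁ q) (forget CommRingCat.{u}) :=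
    reflectsColimit_of_reflectsIsomorphisms _ _
  refine isColimitOfReflects (forget CommRingCat.{u}) ?_
  classical
  refine Types.FilteredColimit.isColimitOf' _ _ (fun x ↦ ?_) (fun t x y h ↦ ⟨t, 𝟙 t, ?_⟩)
  · change q.asIdeal.ResidueField at x
    obtain ⟨a, s, -, rfl⟩ := IsFractionRing.div_surjective (A := B ⧸ q.asIdeal) x
    obtain ⟨a, rfl⟩ := Ideal.Quotient.mk_surjective a
    obtain ⟨s, rfl⟩ := Ideal.Quotient.mk_surjective s
    have ha : a ∈ sub K B (s₁ ∪ {a, s}) := Algebra.subset_adjoin (by simp)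
    have hs : s ∈ sub K B (s₁ ∪ {a, s}) := Algebra.subset_adjoin (by simp)
    refine ⟨⟨s₁ ∪ {a, s}, Finset.subset_union_left⟩,
      algebraMap (sub K B (s₁ ∪ {a, s})) (κ q (sub K B (s₁ ∪ {a, s}))) ⟨a, ha⟩ /
        algebraMap (sub K B (s₁ ∪ {a, s})) (κ q (sub K B (s₁ ∪ {a, s}))) ⟨s, hs⟩, ?_⟩
    change _ = κTo q (sub K B (s₁ ∪ {a, s}))
      (algebraMap (sub K B (s₁ ∪ {a, s})) (κ q (sub K B (s₁ ∪ {a, s}))) ⟨a, ha⟩ /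
        algebraMap (sub K B (s₁ ∪ {a, s})) (κ q (sub K B (s₁ ∪ {a, s}))) ⟨s, hs⟩)
    rw [map_div₀, κTo_algebraMap, κTo_algebraMap]
    rfl
  · have hinj : Function.Injective (κTo q (sub K B t.1)) := RingHom.injective _
    have h' : κTo q (sub K B t.1) x = κTo q (sub K B t.1) y := h
    rw [hinj h']

/-! ### `Spec κ(𝔮) = lim_t Spec κ(𝔮 ∩ K[t])` over `Spec K` -/

/-- The cofiltered diagram of `K`-schemes `t ↦ Spec κ(𝔮 ∩ K[t])`. [folklore] -/
def fibBaseDiagram : (Idx B s₁)ᵒᵖ ⥤ SchemeOver K where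
  obj t := specOver K (κ q (sub K B t.unop.1))
  map f := specOverOfAlgHom (κMap q (sub_mono (K := K) f.unop.le))
  map_id t := by
    ext : 1
    change Spec.map ((fibRingDiagram K B s₁ q).map (𝟙 t.unop)) = 𝟙 _
    rw [(fibRingDiagram K B s₁ q).map_id, Spec.map_id]
  map_comp f g := by
    ext : 1
    change Spec.map ((fibRingDiagram K B s₁ q).map (g.unop ≫ f.unop)) = Spec.map _ ≫ Spec.map _
    rw [(fibRingDiagram K B s₁ q).map_comp, Spec.map_comp]
    rfl

/-- The cone `Spec κ(𝔮) → Spec κ(𝔮 ∩ K[t])` of `K`-schemes. [folklore] -/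
def fibBaseCone : Cone (fibBaseDiagram K B s₁ q) where
  pt := specOver K q.asIdeal.ResidueField
  π := { app t := specOverOfAlgHom (κTo q (sub K B t.unop.1))
         naturality t t' f := by
            ext : 1
            change 𝟙 _ ≫ Spec.map ((fibRingCocone K B s₁ q).ι.app t'.unop) =
              Spec.map ((fibRingCocone K B s₁ q).ι.app t.unop) ≫
                Spec.map ((fibRingDiagram K B s₁ q).map f.unop)
            rw [Category.id_comp, ← Spec.map_comp]
            exact congrArg Spec.map ((fibRingCocone K B s₁ q).w f.unop).symm }

/-- The objects of `fibBaseDiagram` (by `rfl`). [folklore] -/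
theorem fibBaseDiagram_obj (t : (Idx B s₁)ᵒᵖ) :
    (fibBaseDiagram K B s₁ q).obj t = specOver K (κ q (sub K B t.unop.1)) := rfl

/-- The transition maps of `fibBaseDiagram` (by `rfl`). [folklore] -/
theorem fibBaseDiagram_map {t t' : (Idx B s₁)ᵒᵖ} (f : t ⟶ t') :
    (fibBaseDiagram K B s₁ q).map f = specOverOfAlgHom (κMap q (sub_mono (K := K) f.unop.le)) :=
  rfl

/-- The cone point of `fibBaseCone` (by `rfl`). [folklore] -/
theorem fibBaseCone_pt : (fibBaseCone K B s₁ q).pt = specOver K q.asIdeal.ResidueField := rfl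

/-- The legs of `fibBaseCone` (by `rfl`). [folklore] -/
theorem fibBaseCone_π_app (t : (Idx B s₁)ᵒᵖ) :
    (fibBaseCone K B s₁ q).π.app t = specOverOfAlgHom (κTo q (sub K B t.unop.1)) := rfl

/-- `Over.forget` maps `fibBaseCone` to `Spec` of the ring cocone (by `rfl`). [folklore] -/
theorem forget_mapCone_baseCone :
    (Over.forget _).mapCone (fibBaseCone K B s₁ q) =
      Scheme.Spec.mapCone (fibRingCocone K B s₁ q).op := rfl

/-- `Spec κ(𝔮)` is the limit of the `Spec κ(𝔮 ∩ K[t])` in `Scheme`. [folklore] -/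
def isLimitForgetBaseCone : IsLimit ((Over.forget _).mapCone (fibBaseCone K B s₁ q)) := by
  rw [forget_mapCone_baseCone]
  exact isLimitOfPreserves Scheme.Spec (isColimitFibRingCocone K B s₁ q).op

/-- The stages `Spec κ(𝔮 ∩ K[t])` are affine. [folklore] -/
instance isAffine_baseDiagram_obj_left (t : (Idx B s₁)ᵒᵖ) :
    IsAffine ((fibBaseDiagram K B s₁ q).obj t).left :=
  inferInstanceAs (IsAffine (Spec (CommRingCat.of (κ q (sub K B t.unop.1)))))

/-- `Spec κ(𝔮)` is affine. [folklore] -/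
instance isAffine_baseCone_pt_left : IsAffine (fibBaseCone K B s₁ q).pt.left :=
  inferInstanceAs (IsAffine (Spec (CommRingCat.of q.asIdeal.ResidueField)))

/-- The stages `Spec κ(𝔮 ∩ K[t])` are one-point spaces. [folklore] -/
instance subsingleton_baseDiagram_obj_left (t : (Idx B s₁)ᵒᵖ) :
    Subsingleton ((fibBaseDiagram K B s₁ q).obj t).left :=
  inferInstanceAs (Subsingleton (PrimeSpectrum (κ q (sub K B t.unop.1))))

/-- The transition maps `Spec κ(𝔮 ∩ K[t']) → Spec κ(𝔮 ∩ K[t])` are affine. [folklore] -/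
instance isAffineHom_baseDiagram_map_left {t t' : (Idx B s₁)ᵒᵖ} (f : t ⟶ t') :
    IsAffineHom ((fibBaseDiagram K B s₁ q).map f).left :=
  isAffineHom_of_isAffine _

/-- The transition maps `Spec κ(𝔮 ∩ K[t']) → Spec κ(𝔮 ∩ K[t])` are surjective. [folklore] -/
instance surjective_baseDiagram_map_left {t t' : (Idx B s₁)ᵒᵖ} (f : t ⟶ t') :
    Surjective ((fibBaseDiagram K B s₁ q).map f).left :=
  ⟨fun _ => ⟨(default : PrimeSpectrum (κ q (sub K B t.unop.1))), Subsingleton.elim _ _⟩⟩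

/-- The legs `Spec κ(𝔮) → Spec κ(𝔮 ∩ K[t])` are surjective. [folklore] -/
instance surjective_baseCone_π_app_left (t : (Idx B s₁)ᵒᵖ) :
    Surjective ((fibBaseCone K B s₁ q).π.app t).left :=
  ⟨fun _ => ⟨(default : PrimeSpectrum q.asIdeal.ResidueField), Subsingleton.elim _ _⟩⟩

/-! ### The fibre diagram `t ↦ (P ⊗ Spec κ(𝔮 ∩ K[t])).left` and its limit `(P ⊗ Spec κ(𝔮)).left` -/

variable (P : SchemeOver K)

/-- The cofiltered diagram `t ↦ P ×_K Spec κ(𝔮 ∩ K[t]) = (P ⊗ Spec κ(𝔮 ∩ K[t])).left` of the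
fibres of the stages `P ×_K Spec K[t] → Spec K[t]` over the images of `𝔮`. [folklore] -/
def fibDiagram : (Idx B s₁)ᵒᵖ ⥤ Scheme.{u} :=
  fibBaseDiagram K B s₁ q ⋙ tensorLeft P ⋙ Over.forget _

/-- The cone `(P ⊗ Spec κ(𝔮)).left → (P ⊗ Spec κ(𝔮 ∩ K[t])).left`. [folklore] -/
def fibCone : Cone (fibDiagram K B s₁ q P) := tensorLeftCone P (fibBaseCone K B s₁ q)

/-- The objects of `fibDiagram` (by `rfl`). [folklore] -/
theorem fibDiagram_obj (t : (Idx B s₁)ᵒᵖ) :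
    (fibDiagram K B s₁ q P).obj t = (P ⊗ specOver K (κ q (sub K B t.unop.1))).left := rfl

/-- The transition maps of `fibDiagram` (by `rfl`). [folklore] -/
theorem fibDiagram_map {t t' : (Idx B s₁)ᵒᵖ} (f : t ⟶ t') :
    (fibDiagram K B s₁ q P).map f = (P ◁ (fibBaseDiagram K B s₁ q).map f).left := rfl

/-- The cone point of `fibCone` (by `rfl`). [folklore] -/
theorem fibCone_pt : (fibCone K B s₁ q P).pt = (P ⊗ specOver K q.asIdeal.ResidueField).left := rfl

/-- The legs of `fibCone` (by `rfl`). [folklore] -/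
theorem fibCone_π_app (t : (Idx B s₁)ᵒᵖ) :
    (fibCone K B s₁ q P).π.app t = (P ◁ (fibBaseCone K B s₁ q).π.app t).left := rfl

/-- **`(P ⊗ Spec κ(𝔮)).left = lim_t (P ⊗ Spec κ(𝔮 ∩ K[t])).left`**: the fibre `P_{κ(𝔮)}` of
`P ×_K Spec B → Spec B` over `𝔮` is the limit of the fibres `P_{κ(𝔮_t)}` of the stages
`P ×_K Spec K[t] → Spec K[t]` over the images `𝔮_t` of `𝔮` (Görtz–Wedhorn I, (10.13); The Stacks
Project, Tag 01YT). [cite: GortzWedhorn2020, (10.13), p. 321] -/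
def isLimitFibCone : IsLimit (fibCone K B s₁ q P) :=
  isLimitTensorLeftCone P (fibBaseCone K B s₁ q) (isLimitForgetBaseCone K B s₁ q)

/-- The transition maps of `fibDiagram` are affine. [folklore] -/
instance isAffineHom_fibDiagram_map {t t' : (Idx B s₁)ᵒᵖ} (f : t ⟶ t') :
    IsAffineHom ((fibDiagram K B s₁ q P).map f) := by
  rw [fibDiagram_map]; infer_instance

/-- The transition maps of `fibDiagram` are surjective. [folklore] -/
instance surjective_fibDiagram_map {t t' : (Idx B s₁)ᵒᵖ} (f : t ⟶ t') :
    Surjective ((fibDiagram K B s₁ q P).map f) := by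
  rw [fibDiagram_map]; infer_instance

/-- The transition maps of `fibDiagram` are dominant. [folklore] -/
instance isDominant_fibDiagram_map {t t' : (Idx B s₁)ᵒᵖ} (f : t ⟶ t') :
    IsDominant ((fibDiagram K B s₁ q P).map f) := by
  rw [fibDiagram_map]; infer_instance

/-- The legs of `fibCone` are surjective. [folklore] -/
instance surjective_fibCone_π_app (t : (Idx B s₁)ᵒᵖ) :
    Surjective ((fibCone K B s₁ q P).π.app t) := by
  rw [fibCone_π_app]; infer_instance

/-- The legs of `fibCone` are dominant. [folklore] -/
instance isDominant_proj_fibCone (t : (Idx B s₁)ᵒᵖ) :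
    IsDominant (proj (fibDiagram K B s₁ q P) (fibCone K B s₁ q P) t) := by
  change IsDominant ((fibCone K B s₁ q P).π.app t)
  rw [fibCone_π_app]; infer_instance

/-- The objects of `fibDiagram` are integral. [folklore] -/
instance isIntegral_fibDiagram_obj [GeometricallyIntegral P.hom] (t : (Idx B s₁)ᵒᵖ) :
    IsIntegral ((fibDiagram K B s₁ q P).obj t) := by
  rw [fibDiagram_obj]; infer_instance

/-- The cone point of `fibCone` is integral. [folklore] -/
instance isIntegral_fibCone_pt [GeometricallyIntegral P.hom] :
    IsIntegral (fibCone K B s₁ q P).pt := by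
  rw [fibCone_pt]; infer_instance

/-- The objects of `fibDiagram` are quasi-compact. [folklore] -/
instance compactSpace_fibDiagram_obj [QuasiCompact P.hom] (t : (Idx B s₁)ᵒᵖ) :
    CompactSpace ((fibDiagram K B s₁ q P).obj t) := by
  rw [fibDiagram_obj]
  haveI : CompactSpace (specOver K (κ q (sub K B t.unop.1))).left :=
    inferInstanceAs (CompactSpace (Spec (CommRingCat.of (κ q (sub K B t.unop.1)))))
  infer_instance

/-- The objects of `fibDiagram` are quasi-separated. [folklore] -/
instance quasiSeparatedSpace_fibDiagram_obj [QuasiSeparated P.hom] (t : (Idx B s₁)ᵒᵖ) :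
    QuasiSeparatedSpace ((fibDiagram K B s₁ q P).obj t) := by
  rw [fibDiagram_obj]
  haveI : QuasiSeparatedSpace (specOver K (κ q (sub K B t.unop.1))).left :=
    inferInstanceAs (QuasiSeparatedSpace (Spec (CommRingCat.of (κ q (sub K B t.unop.1)))))
  infer_instance

/-! ### Legs and transition maps with their sources and targets displayed as `Spec`s -/

/-- The leg `Spec κ(𝔮) → Spec κ(𝔮 ∩ K[t])` of `fibBaseCone`. [folklore] -/
abbrev legF (t : (Idx B s₁)ᵒᵖ) :
    specOver K q.asIdeal.ResidueField ⟶ specOver K (κ q (sub K B t.unop.1)) :=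
  (fibBaseCone K B s₁ q).π.app t

/-- The transition map `Spec κ(𝔮 ∩ K[t]) → Spec κ(𝔮 ∩ K[t'])` of `fibBaseDiagram`. [folklore] -/
abbrev mapF {t t' : (Idx B s₁)ᵒᵖ} (f : t ⟶ t') :
    specOver K (κ q (sub K B t.unop.1)) ⟶ specOver K (κ q (sub K B t'.unop.1)) :=
  (fibBaseDiagram K B s₁ q).map f

/-- The leg `Spec B → Spec K[t]` of `SubalgApprox.baseCone`. [folklore] -/
abbrev legB (t : (Idx B s₁)ᵒᵖ) : specOver K B ⟶ specOver K ↥(sub K B t.unop.1) :=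
  (Literature.AlgebraicGeometry.Limits.SubalgApprox.baseCone K B s₁).π.app t

/-- The transition map `Spec K[t] → Spec K[t']` of `SubalgApprox.baseDiagram`. [folklore] -/
abbrev mapB {t t' : (Idx B s₁)ᵒᵖ} (f : t ⟶ t') :
    specOver K ↥(sub K B t.unop.1) ⟶ specOver K ↥(sub K B t'.unop.1) :=
  (Literature.AlgebraicGeometry.Limits.SubalgApprox.baseDiagram K B s₁).map f

/-- `Spec κ(𝔮) → Spec κ(𝔮 ∩ K[t]) → Spec K[t]` is `Spec κ(𝔮) → Spec B → Spec K[t]`. [folklore] -/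
theorem legF_jHom (t : (Idx B s₁)ᵒᵖ) :
    legF K B s₁ q t ≫ jHom q (sub K B t.unop.1) = εHom q ≫ legB K B s₁ t :=
  κTo_jHom q _

/-- `Spec κ(𝔮 ∩ K[t]) → Spec κ(𝔮 ∩ K[t']) → Spec K[t']` is
`Spec κ(𝔮 ∩ K[t]) → Spec K[t] → Spec K[t']`. [folklore] -/
theorem mapF_jHom {t t' : (Idx B s₁)ᵒᵖ} (f : t ⟶ t') :
    mapF K B s₁ q f ≫ jHom q (sub K B t'.unop.1) = jHom q (sub K B t.unop.1) ≫ mapB K B s₁ f :=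
  κMap_jHom q (sub_mono (K := K) (t := t'.unop.1) (t' := t.unop.1) f.unop.le)

/-- The point `t'_t ∈ Spec K[t]` below `𝔮 ∈ Spec B` is `pt 𝔮 K[t]` (by `rfl`). [folklore] -/
theorem legB_apply (t : (Idx B s₁)ᵒᵖ) : (legB K B s₁ t).left q = pt q (sub K B t.unop.1) := rfl

end Diagram

end ResidueFieldApprox

/-! ### Proof of `trivialLocus_descendsAlongStages` -/

section Discharge

open Literature.AlgebraicGeometry.Limits.SubalgApprox (Idx sub sub_mono hom_eq leg prodDiagram
  prodCone)
open ResidueFieldApprox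

/-- **The fibre condition `t ∈ Z` descends along `Spec B = lim_t Spec K[t]`** (discharge of
`trivialLocus_descendsAlongStages`): the class of `E₀` restricted to the fibre
`P_{κ(t')} = (P ⊗ Spec κ(𝔭)).left`, `𝔭 = t'`, is trivial by hypothesis; this fibre is the limit of
the fibres `P_{κ(t'_t)} = (P ⊗ Spec κ(𝔭 ∩ K[t])).left` of the stages (`isLimitFibCone`:
`κ(𝔭) = Frac(B/𝔭)` is the directed union of the `κ(𝔭 ∩ K[t]) = Frac(K[t]/𝔭 ∩ K[t])`, a
cofiltered limit of integral schemes with affine surjective transition maps), so by the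
injectivity half of `Pic(lim S_i) = colim Pic(S_i)` (`exists_linEquiv_zero_pullback_map`,
`Limits/CartierDivisorLinEquiv`; The Stacks Project, Lemma 32.10.2 = Tag 01ZR (2), (3), cf.
Lemma 32.10.3 = Tag 0B8W; Görtz–Wedhorn I, Exercise 10.32 (b)) the restriction of `E₀` to some
`P_{κ(t'_{t₁})}` is already trivial. The identifications of the residue fields of the affine
schemes `Spec K[t]`, `Spec B` with `κ(𝔭 ∩ K[t])`, `κ(𝔭)` are Mathlib's `Scheme.Spec.residueFieldIso`.
[cite: StacksProject, Tag 01ZR (2), (3) and Tag 0B8W; GortzWedhorn2020, Exercise 10.32 (b)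
(p. 353) and (10.13) (p. 321)] -/
theorem trivialLocus_descendsAlongStages_holds : trivialLocus_descendsAlongStages.{u} := by
  intro K _ P _ _ B _ _ _ s₁ _ t₀ E₀ t' ht
  classical
  haveI : Quiver.IsThin (Idx B s₁)ᵒᵖ := fun _ _ => ⟨fun f g => hom_eq f g⟩
  haveI : IsIntegral (P ⊗ specOver K ↥(sub K B t₀.unop.1)).left :=
    Literature.AlgebraicGeometry.Limits.SubalgApprox.isIntegral_prodDiagram_obj B s₁ P t₀
  haveI : IsIntegral (prodCone K B s₁ P).pt := ‹IsIntegral (P ⊗ specOver K B).left›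
  have ht' := CartierDivisor.mem_trivialLocus_iff.mp ht
  -- the class of `E₀` on the fibre stage `P_{κ(t'_{t₀})} = (P ⊗ Spec κ(𝔭 ∩ K[t₀])).left`
  let F : CartierDivisor (P ⊗ specOver K (κ t' (sub K B t₀.unop.1))).left :=
    E₀.classPullback (P ◁ jHom t' (sub K B t₀.unop.1)).left
  -- Step 1: `F` dies on the limit `P_{κ(t')}`
  have hF : (F.pullback (proj (fibDiagram K B s₁ t' P) (fibCone K B s₁ t' P) t₀)).LinEquiv 0 := by
    refine (F.classPullback_linEquiv_pullback _).symm.trans ?_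
    refine (CartierDivisor.classPullback_whiskerLeft_comp_linEquiv' P (jHom t' (sub K B t₀.unop.1))
      (legF K B s₁ t' t₀) E₀).symm.trans ?_
    refine (CartierDivisor.LinEquiv.of_eq (CartierDivisor.classPullback_congr
      (congrArg (fun g => (P ◁ g).left) (legF_jHom K B s₁ t' t₀)) E₀)).trans ?_
    refine (CartierDivisor.classPullback_whiskerLeft_comp_linEquiv' P (legB K B s₁ t₀) (εHom t')
      E₀).trans ?_
    refine ((E₀.classPullback_linEquiv_pullback (leg B s₁ P t₀)).classPullback
      (P ◁ εHom t').left).trans ?_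
    refine (CartierDivisor.LinEquiv.of_eq (CartierDivisor.classPullback_congr
      (congrArg (fun g => (P ◁ g).left) (εHom_eq t')) _)).trans ?_
    refine (CartierDivisor.classPullback_whiskerLeft_comp_linEquiv' P
      (residuePtι (specOver K B) t') (eBHom t') _).trans ?_
    exact ht'.classPullback_zero _
  -- Step 2: hence `F` dies on some finer fibre stage `P_{κ(t'_{t₁})}`
  obtain ⟨t₁, f, h₁⟩ := exists_linEquiv_zero_pullback_map (fibDiagram K B s₁ t' P)
    (fibCone K B s₁ t' P) (isLimitFibCone K B s₁ t' P) (i := t₀) F hF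
  refine ⟨t₁, f, ?_⟩
  haveI : IsIntegral (P ⊗ specOver K ↥(sub K B t₁.unop.1)).left :=
    Literature.AlgebraicGeometry.Limits.SubalgApprox.isIntegral_prodDiagram_obj B s₁ P t₁
  haveI : IsIntegral (P ⊗ (Literature.AlgebraicGeometry.Limits.SubalgApprox.baseDiagram
      K B s₁).obj t₁).left :=
    Literature.AlgebraicGeometry.Limits.SubalgApprox.isIntegral_prodDiagram_obj B s₁ P t₁
  -- Step 3: transport to the fibre of `(D f)^* E₀` over `t'_{t₁}`
  refine CartierDivisor.mem_trivialLocus_iff.mpr ?_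
  refine ((E₀.classPullback_linEquiv_pullback ((prodDiagram K B s₁ P).map f)).classPullback
    _).symm.trans ?_
  refine (CartierDivisor.LinEquiv.of_eq (CartierDivisor.classPullback_congr
      (congrArg (fun g => (P ◁ g).left) (eHom_jHom t' (sub K B t₁.unop.1))) _)).trans ?_
  refine (CartierDivisor.classPullback_whiskerLeft_comp_linEquiv' P (jHom t' (sub K B t₁.unop.1))
    (eHom t' (sub K B t₁.unop.1)) _).trans ?_
  refine CartierDivisor.LinEquiv.classPullback_zero _ ?_
  refine (CartierDivisor.classPullback_whiskerLeft_comp_linEquiv' P (mapB K B s₁ f)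
    (jHom t' (sub K B t₁.unop.1)) E₀).symm.trans ?_
  refine (CartierDivisor.LinEquiv.of_eq (CartierDivisor.classPullback_congr
      (congrArg (fun g => (P ◁ g).left) (mapF_jHom K B s₁ t' f).symm) E₀)).trans ?_
  refine (CartierDivisor.classPullback_whiskerLeft_comp_linEquiv' P (jHom t' (sub K B t₀.unop.1))
    (mapF K B s₁ t' f) E₀).trans ?_
  exact (F.classPullback_linEquiv_pullback _).trans h₁

end Discharge

/-- **Noetherian descent of the cube data holds outright** (`theoremOfCube_noetherianDescent` of
`Motives/TheoremOfCubeLimit`, from `theoremOfCube_noetherianDescent_of_trivialLocus_descends` and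
the discharge `trivialLocus_descendsAlongStages_holds`).
[cite: GortzWedhorn2023, Thm. 23.133, proof, Step (IV) (p. 479), as used for Lemma 24.72 (p. 548)] -/
theorem theoremOfCube_noetherianDescent_holds : theoremOfCube_noetherianDescent.{u} :=
  theoremOfCube_noetherianDescent_of_trivialLocus_descends trivialLocus_descendsAlongStages_holds

/-- **The trust base of `theoremOfCube_isTrivialOver_nhds` after this file**: Step (I)
(`theoremOfCube_trivialAlong_thickeningPt`) and the theorem on formal functions for `H⁰` of `𝒪(D)`
(`formalFunctions_exists_isSectionOver_restrict`) only.
[cite: GortzWedhorn2023, Lemma 24.72, proof (pp. 548–549), with Thm. 23.133, Step (IV) (p. 479)] -/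
theorem theoremOfCube_isTrivialOver_nhds_of_cube_stepI_of_formalFunctions
    (HI : theoremOfCube_trivialAlong_thickeningPt.{u})
    (HF : formalFunctions_exists_isSectionOver_restrict.{u}) :
    theoremOfCube_isTrivialOver_nhds.{u} :=
  theoremOfCube_isTrivialOver_nhds_of_cube_stepI_of_formalFunctions_of_fibre HI HF
    trivialLocus_descendsAlongStages_holds

end Literature.AlgebraicGeometry.Motives

end
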